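import Summits.Ventures.Crystal3D.Bulk.GapOrientation
import HarnessLib

/-!
# The FAMCERT socket: the rows engine-2's `famcert` imposes on a census cell hold at every
# configuration satisfying `CensusRows`

HONEST FRAMING. Part of the venture `Summits/Ventures/Crystal3D` (cell `pub-crystal3d`, phase 2,
promotion audit of the GAP(1.26) census; written by seat engine-2, filed by a typer seat).
Bookkeeping file in the form of `Bulk/GapIrrSocket.lean` (implementation A's IRR socket): a kernel
statement about ONE fourteen-ball configuration `c` under the census hypothesis `CensusRows c`
(`Bulk/GapCensusRows.lean`). It certifies no box, books no kill and asserts nothing about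
GAP(1.26). It packages, as ONE theorem, the tree facts that license the constraint rows of
engine-2's certified chart branch-and-bound `famcert` (cell files
`pub-crystal3d-engine-2/famcert/famcert2-v3.c`, sha256:16 `e5f7cec0b848bd5f`, rows at
l.166–169 / l.213–218; producer dossier `pub-crystal3d-engine-2/famcert/audit-prep-g11/`): with
`x_v = c v − c 0` the direction of shell ball `v`, `p = gapDir c 13` the hole direction and
`D = intruderDist c`,

* E1: a tight shell pair has `⟪x_j, x_k⟫ = 1/2`; S1: any two shell balls have `⟪x_j, x_k⟫ ≤ 1/2`;
* E2: a hole contact has `⟪x_i, p⟫ = D/2` (famcert's `cos t` is `D/2`); S2: every shell ball has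
  `⟪x_j, p⟫ ≤ D/2`;
* C: at EVERY vertex `i` of the tight map — shell balls and the hole `13` — and every tight
  partner `j`, `0 < orient3 (gapDir c i) (gapDir c j) (gapDir c (onextNbr c i j))`, i.e.
  `det[x_i, x_j, x_succ(j)] > 0` for the oriented successor (famcert kills a box by a corner row
  only when this determinant is certainly `< 0`).

NOT kernel statements (named in the dossier, for the audit): the identification of a census KEY's
rotation system with `onextNbr c` up to one global reversal (generator completeness / keying),
the `r ≥ 1` frame ⇒ cell inference, and that the C program computes the chart it documents.
-/

noncomputable section

namespace Summit.Ventures.Crystal3D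

open scoped InnerProductSpace RealInnerProductSpace
open Literature.Geometry.DiscreteGeometry Real

variable {c : Fin 14 → EuclideanSpace ℝ (Fin 3)}

/-- **FAMCERT socket.** Under `CensusRows c`: (E1) touching shell balls are at inner product
`1/2`; (S1) any two shell balls at `≤ 1/2`; (E2) a shell ball touching the intruder is at level
`D/2` along the hole direction; (S2) every shell ball is at level `≤ D/2`; (C) at every vertex of
the tight map, shell or hole, the oriented successor of every tight partner is on the positive
side: `0 < orient3 xᵢ xⱼ x_{succ}` — the five row families of engine-2's `famcert`. -/
theorem CensusRows.famcertRows (h : CensusRows c) :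
    (∀ j k : Fin 14, j ≠ 0 → j ≠ 13 → k ≠ 0 → k ≠ 13 → dist (c j) (c k) = 1 →
        ⟪c j - c 0, c k - c 0⟫_ℝ = 1 / 2) ∧
    (∀ j k : Fin 14, j ≠ 0 → j ≠ 13 → k ≠ 0 → k ≠ 13 → j ≠ k →
        ⟪c j - c 0, c k - c 0⟫_ℝ ≤ 1 / 2) ∧
    (∀ i : Fin 14, i ≠ 0 → i ≠ 13 → dist (c i) (c 13) = 1 →
        ⟪c i - c 0, gapDir c 13⟫_ℝ = intruderDist c / 2) ∧
    (∀ j : Fin 14, j ≠ 0 → j ≠ 13 → ⟪c j - c 0, gapDir c 13⟫_ℝ ≤ intruderDist c / 2) ∧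
    (∀ i j : Fin 14, i ≠ 0 → j ∈ tightNbrs c i →
        0 < orient3 (gapDir c i) (gapDir c j) (gapDir c (onextNbr c i j))) := by
  have hc : IsGapConfig c := h.isGapConfig
  have hD3 : intruderDist c ^ 2 < 3 := h.intruderDist_bounds.1
  refine ⟨fun j k hj0 hj13 hk0 hk13 hd => hc.inner_sub_eq_half hj0 hj13 hk0 hk13 hd,
    fun j k hj0 hj13 hk0 hk13 hjk => hc.inner_sub_le_half hj0 hj13 hk0 hk13 hjk,
    fun i hi0 hi13 hd => ?_, fun j hj0 hj13 => ?_,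
    fun i j hi0 hj => hc.orient3_onextNbr_pos hD3 hi0 hj (h.odartGap_lt_pi hi0 hj)⟩
  · simpa [gapDir] using hc.inner_dir_intruder_of_touch hi0 hi13 hd
  · simpa [gapDir] using hc.inner_dir_intruder_le hj0 hj13

end Summit.Ventures.Crystal3D
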